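import Summits.QuantumAdvantage.QuantumAdvantage.Theorems.CubicForrelationNearExactIsExactTwelveQuadSpectrum

/-!
# Crux `CubicForrelation.NearExactIsExact` (stmt-QuantumAdvantage-14043) — quadratic sign patterns on a half-space of `𝔽₂¹²`: the PARITY of the
  transform (dual of a bent quadratic is quadratic; the odd set of `Ŝ/64` is a derivative set of a quadratic)

Certificate seat `b2b-cforr-cert` (gen 18).  HONEST FRAMING: infrastructure lemmas (standard axioms) for the last open configuration at
`Φ = 932/1024` on 12 bits (`…TwelveLevelFive932Dead`); finite-slice bookkeeping, NOT summit progress.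

* `qs_dual_quadratic`: if `D` is quadratic on 12 bits with `W_D = 64·v`, `v = ±1` everywhere, then `y ↦ [v(y) = −1]` (the dual) is again
  QUADRATIC — Poisson summation over coordinate cubes + Ax at `d = 2` + binary Möbius inversion (no theory of quadratic forms).
* `qs_hyperplane_sum_parity`: for quadratic `D` and `P = {(−1)^{γ·x} = t}`: `Σ_{x∈P} (−1)^{D(x)+x·y} = 64·m(y)` where EITHER every `m(y)` is
  even, OR `|m| ≤ 2` everywhere and `{m odd} = {y : h(y) ⊕ h(y ⊕ γ) = c}` for a QUADRATIC `h` and a constant `c` (so `{m odd}` has `0`, `2048`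
  or `4096` points, `h ⊕ h(· ⊕ γ)` being affine).

References: O. S. Rothaus (1976); MacWilliams–Sloane (1977) Ch. 14 §5, Ch. 15 §2; C. Carlet (2021) §4.1, §6.1.  Everything below is proved from
Mathlib and the tree; axioms are the standard three.
-/

set_option linter.dupNamespace false -- D-0017: single-problem summit ⇒ `QuantumAdvantage.QuantumAdvantage` by design

noncomputable section

namespace Summit.QuantumAdvantage.QuantumAdvantage.Theorems.CubicForrelation.NearExactIsExact

open Finset
open Literature.Computability.QuantumComplexity
open Literature.Computability.QuantumComplexity.BuzetChailloux (bxor zeroVec twist_bxor_right bxor_comm)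
open Literature.Computability.QuantumComplexity.DerivativeWalsh (W sum_W_sq)
open Literature.Computability.QuantumComplexity.Simon (twist_eq_one_or)

/-! ### The dual of a bent quadratic is quadratic -/

/-- **The dual of a bent QUADRATIC on 12 bits is quadratic**: `W_D = 64·v` with `v = ±1` ⇒ `deg [v = −1] ≤ 2`.  For a coordinate set `I` with
`|I| ≥ 3`, Poisson gives `64·Σ_{E_I} v = 2^{|I|}·Σ_{E_{Iᶜ}} (−1)^D = 2^{|I| + ⌈(12−|I|)/2⌉}·z` (Ax, `d = 2`), so `#{y ∈ E_I : v(y) = −1}` is even;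
conclude by Möbius inversion. [cite: MacWilliamsSloane1977, Ch. 14 §5] -/
theorem qs_dual_quadratic (D : (Fin (6 + 6) → Bool) → Bool) (hD : IsDegLeFun 2 D) (v : (Fin (6 + 6) → Bool) → ℤ)
    (hv : ∀ y, W (fun x => signOf (D x)) y = (2 : ℝ) ^ 6 * (v y : ℝ)) (hpm : ∀ y, v y = 1 ∨ v y = -1) :
    IsDegLeFun 2 (fun y => decide (v y = -1)) := by
  classical
  refine bb_moebius_isDegLeFun 2 _ fun I hI => ?_
  have hP := bb_poisson (fun y => signOf (D y)) I
  obtain ⟨z, hz⟩ := stub_axParity (6 + 6) 2 D Iᶜ (by norm_num) hD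
  rw [sum_congr rfl fun x _ => hv x, ← mul_sum, hz] at hP
  have hk : #I ≤ 12 := (card_le_univ I).trans_eq (by simp)
  have hj : #Iᶜ = 12 - #I := by rw [card_compl]; simp
  set EI := (univ.filter fun u : Fin (6 + 6) → Bool => ∀ i, u i = true → i ∈ I) with hEI
  have hcardEI : #EI = 2 ^ #I := bb_card_cube I
  set N := #(EI.filter fun u => v u = -1) with hN
  have hsumv : ∑ x ∈ EI, v x = #EI - 2 * (N : ℤ) := by
    have e : ∀ x, v x = 1 - 2 * (if v x = -1 then (1 : ℤ) else 0) := fun x => by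
      rcases hpm x with h | h <;> simp [h]
    rw [sum_congr rfl fun x _ => e x, sum_sub_distrib, sum_const, nsmul_eq_mul, mul_one, ← mul_sum, sum_boole]
  have hZ : (2 : ℤ) ^ 6 * (2 ^ #I - 2 * (N : ℤ)) = 2 ^ #I * (2 ^ ((#Iᶜ + 2 - 1) / 2) * z) := by
    have h'' : (2 : ℤ) ^ 6 * ∑ x ∈ EI, v x = 2 ^ #I * (2 ^ ((#Iᶜ + 2 - 1) / 2) * z) := by exact_mod_cast hP
    rw [hsumv, hcardEI] at h''
    push_cast at h''
    exact h''
  have hNeven : Even N := by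
    rw [hj] at hZ
    rw [Nat.even_iff]
    obtain ⟨a, ha⟩ : ∃ a, #I = a := ⟨_, rfl⟩
    rw [ha] at hZ hI hk
    interval_cases a <;> norm_num at hZ <;> omega
  have e : (univ.filter fun u : Fin (6 + 6) → Bool => (∀ i, u i = true → i ∈ I) ∧ decide (v u = -1) = true) =
      EI.filter fun u => v u = -1 := by
    rw [hEI, filter_filter]; exact filter_congr fun u _ => by simp
  rw [e]; exact hNeven

/-! ### The parity of the half-space transform -/

/-- **Half-space transform of a quadratic sign pattern, with the parity of the quotient.**  For quadratic `D` on 12 bits and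
`P = {x : (−1)^{γ·x} = t}`: `Σ_{x∈P} (−1)^{D(x)}(−1)^{x·y} = 64·m(y)` and EITHER `m(y)` is even for every `y`, OR `|m(y)| ≤ 2` for every `y` and
`{m odd} = {y : h(y) ⊕ h(y ⊕ γ) = c}` for some QUADRATIC `h` and `c ∈ 𝔽₂` (levels `j ≥ 8`, resp. `j = 7` with `h = [v odd]` and `j = 6` with `h` the
dual, of `qs_spectrum`).  NOT summit progress. [this work] -/
theorem qs_hyperplane_sum_parity (D : (Fin (6 + 6) → Bool) → Bool) (hD : IsDegLeFun 2 D) (γ : Fin (6 + 6) → Bool) (t : ℝ)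
    (ht : t = 1 ∨ t = -1) :
    ∃ m : (Fin (6 + 6) → Bool) → ℤ,
      (∀ y, ∑ x ∈ univ.filter (fun x : Fin (6 + 6) → Bool => twist γ x = t), (sZ (D x) : ℝ) * twist x y = 64 * (m y : ℝ)) ∧
      ((∀ y, Even (m y)) ∨
        ((∀ y, |m y| ≤ 2) ∧ ∃ (h : (Fin (6 + 6) → Bool) → Bool) (c : Bool), IsDegLeFun 2 h ∧
          ∀ y, (Odd (m y) ↔ (h y ^^ h (bxor y γ)) = c))) := by
  classical
  obtain ⟨tZ, htZ, htZ'⟩ : ∃ tZ : ℤ, (tZ : ℝ) = t ∧ (tZ = 1 ∨ tZ = -1) := by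
    rcases ht with rfl | rfl
    · exact ⟨1, by norm_num, Or.inl rfl⟩
    · exact ⟨-1, by norm_num, Or.inr rfl⟩
  obtain ⟨j, hj6, hj12, v, hv, hval, hsupp⟩ := qs_spectrum D hD
  have hS : ∀ y, ∑ x ∈ univ.filter (fun x : Fin (6 + 6) → Bool => twist γ x = t), (sZ (D x) : ℝ) * twist x y =
      2 ^ j * ((v y : ℝ) + tZ * v (bxor y γ)) / 2 := by
    intro y
    have h := qs_halfspace (fun x => ((sZ (D x) : ℤ) : ℝ)) γ t ht y
    have e : (fun x : Fin (6 + 6) → Bool => ((sZ (D x) : ℤ) : ℝ)) = fun x => signOf (D x) := funext fun x => tp_sZ_cast _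
    rw [e, hv, hv, bxor_comm γ y] at h
    rw [h, ← htZ]; ring
  by_cases hj8 : 8 ≤ j
  · refine ⟨fun y => 2 ^ (j - 7) * (v y + tZ * v (bxor y γ)), fun y => ?_, Or.inl fun y => ?_⟩
    · show _ = 64 * (((2 ^ (j - 7) * (v y + tZ * v (bxor y γ)) : ℤ)) : ℝ)
      rw [hS y]
      obtain ⟨i, hi⟩ : ∃ i, j = i + 8 := ⟨j - 8, by omega⟩
      subst hi
      rw [show i + 8 - 7 = i + 1 by omega]
      push_cast
      ring
    · show Even (2 ^ (j - 7) * (v y + tZ * v (bxor y γ)))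
      obtain ⟨i, hi⟩ : ∃ i, j - 7 = i + 1 := ⟨j - 8, by omega⟩
      rw [hi, pow_succ]
      exact ⟨2 ^ i * (v y + tZ * v (bxor y γ)), by ring⟩
  · by_cases hj7 : j = 7
    · subst hj7
      -- `h = [v odd]` has degree `≤ 2` (tower at level 7)
      have hdeg : IsDegLeFun 2 (fun y => decide (Odd (v y))) :=
        qs_walshTower2 (6 + 6) 7 2 D v hD hv (by intro k hk hkn; omega)
      refine ⟨fun y => v y + tZ * v (bxor y γ), fun y => ?_, Or.inr ⟨fun y => ?_, fun y => decide (Odd (v y)), true, hdeg, fun y => ?_⟩⟩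
      · show _ = 64 * (((v y + tZ * v (bxor y γ) : ℤ)) : ℝ)
        rw [hS y]; push_cast; ring
      · show |v y + tZ * v (bxor y γ)| ≤ 2
        rw [abs_le]
        rcases hval y with h | h | h <;> rcases hval (bxor y γ) with h' | h' | h' <;> rcases htZ' with h'' | h'' <;>
          rw [h, h', h''] <;> norm_num
      · show Odd (v y + tZ * v (bxor y γ)) ↔ (decide (Odd (v y)) ^^ decide (Odd (v (bxor y γ)))) = true
        rcases hval y with h | h | h <;> rcases hval (bxor y γ) with h' | h' | h' <;> rcases htZ' with h'' | h'' <;>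
          rw [h, h', h''] <;> decide
    · have hj : j = 6 := by omega
      subst hj
      -- `v = ±1` everywhere; `h` = the dual
      have hne : ∀ y, v y ≠ 0 := by
        intro y
        have hcard : #(univ.filter fun y : Fin (6 + 6) → Bool => v y ≠ 0) = #(univ : Finset (Fin (6 + 6) → Bool)) := by
          apply le_antisymm (card_le_univ _)
          simp only [Fintype.card_fun, Fintype.card_bool, Fintype.card_fin]
          norm_num at hsupp ⊢
          exact hsupp
        have hmem : y ∈ univ.filter fun y : Fin (6 + 6) → Bool => v y ≠ 0 := by
          rw [eq_univ_of_card _ hcard]; exact mem_univ _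
        exact (mem_filter.1 hmem).2
      have hpm : ∀ y, v y = 1 ∨ v y = -1 := fun y => (hval y).resolve_left (hne y)
      have hdual := qs_dual_quadratic D hD v hv hpm
      obtain ⟨c, hc⟩ : ∃ c : Bool, c = decide (tZ = -1) := ⟨_, rfl⟩
      refine ⟨fun y => (v y + tZ * v (bxor y γ)) / 2, fun y => ?_,
        Or.inr ⟨fun y => ?_, fun y => decide (v y = -1), c, hdual, fun y => ?_⟩⟩
      · show _ = 64 * ((((v y + tZ * v (bxor y γ)) / 2 : ℤ)) : ℝ)
        rw [hS y]
        rcases hpm y with h | h <;> rcases hpm (bxor y γ) with h' | h' <;> rcases htZ' with h'' | h'' <;> rw [h, h', h''] <;> norm_num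
      · show |(v y + tZ * v (bxor y γ)) / 2| ≤ 2
        rcases hpm y with h | h <;> rcases hpm (bxor y γ) with h' | h' <;> rcases htZ' with h'' | h'' <;> rw [h, h', h''] <;> norm_num
      · show Odd ((v y + tZ * v (bxor y γ)) / 2) ↔ (decide (v y = -1) ^^ decide (v (bxor y γ) = -1)) = c
        rw [hc]
        rcases hpm y with h | h <;> rcases hpm (bxor y γ) with h' | h' <;> rcases htZ' with h'' | h'' <;> rw [h, h', h''] <;> decide

end Summit.QuantumAdvantage.QuantumAdvantage.Theorems.CubicForrelation.NearExactIsExact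

end
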